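import Literature.AnabelianGeometry.EtaleTheta.Discharge.Sec5Prop55OfConnectedTemperoidLevelN
import Literature.AnabelianGeometry.EtaleTheta.Discharge.Sec5LevelNCoefficientMap

/-!
# [EtTh] Prop. 5.5 at the genuine §5 data over `B^temp(Π^tp_X)⁰` with `Q := levelStub` (level `N`): the binders `e`, `he`, `hPproj`, `hproj` DISCHARGED under the projection pin on `P` at `B_N^bs`

Mochizuki, *The étale theta function and its Frobenioid-theoretic manifestations*, Publ. RIMS **45** (2009), Prop. 5.5 pp. 327–328 (PDF pp. 101–102);
§2 p. 46 ("`(l·Δ_Θ) ↠ (l·Δ_Θ) ⊗ ℤ/Nℤ ≅ μ_N`").  [cite: MochizukiEtTh2009, Prop 5.5 p.327–328 (PDF pp.101–102)]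

PROOF-ONLY (no definitions).  abc-iut cell, seat abc-iut-w4-d042 (gen 4): sequel of `Discharge/Sec5Prop55OfConnectedTemperoidLevelN.lean` (p432174:
`hpre`, `hlift`, `hgeom` of abc-iut-L2-t4's `cyclotomicRigidity_ofConnectedTemperoidData_of_pullRoot`, p430047, at `Q := RD.levelStub ιX` over
`mkOfConnectedTemperoidYdd`, given the ONE equation `hPpre` pinning `P.pre` at `B_N^bs` to print's `Aut`-subquotient domain `autPre`) and of the record-free
coefficient map `Discharge/Sec5LevelNCoefficientMap.lean` (p440814).  Adding the SECOND pin — cast-free — that `P.proj` at `B_N^bs` IS print's `autProj` read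
through the fully faithful inclusion,

  `hPproj_pin : ∀ (σ : P.pre B_N^bs) (τ : autPre q_N ι_N (B_N^bs)), mapAut σ = τ → (P.proj B_N^bs σ : (l·Δ_Θ ⊗ ℤ/Nℤ)_{B_N^bs}) = autProj q_N ι_N (B_N^bs) τ`

(both pins are `rfl` / `Subtype.ext` for abc-iut-L2-t4's planned v-next term, GAP-LEDGER G-w4d042g3-1 plan (a); until then `P` stays a binder honestly), the
binders `e`, `he`, `hPproj` — `exists_coeffMap_levelN_of_pin`, in EXACTLY p430047's binder types, ∃-packaged — and the structural leaf `hproj` —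
`hproj_levelN_of_pin`, p430047's binder type verbatim — are THEOREMS: `(e, he, hPproj)` by p440814's `exists_coeffMap_autProj_levelN` through the pin (one
defeq conversion `(l·Δ_Θ)_{B_N} ⊗ ℤ/Nℤ = (levelStub).lDelta B_N^bs ⧸ N-th powers`), `hproj` by abc-iut-w4-d042's conjugation law `ThetaSubquotient.map_autProj_eq_autProj_conj`
(p429126) read through p432174's `rfl` dictionary `ofConnectedTemperoidData_levelN_lDeltaMap` (the data's transport IS abc-iut-L2-t9's `map`).  So for the
level-`N` R2 carrier the `(Q,P)`-binders {hpre, hlift, hgeom, e, he, hPproj, hproj} of Prop. 5.5 are theorems modulo the two pin equations on `P` at `B_N^bs`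
(and `hLc`/`hLi` by abc-iut-L2-t9's `Discharge/Sec5LDeltaMapLawsOfStub.lean`, p438458).  Nothing of [EtTh]'s curves is asserted; typed ≠ proved for the remaining
named binders; no side taken on [IUTchIII] Cor. 3.12.
-/

noncomputable section

namespace Literature.AnabelianGeometry.EtaleTheta

namespace ThetaFrobenioid

open CategoryTheory Opposite FrobenioidCyclotomicRigidity Literature.AlgebraicGeometry.Frobenioids
  Literature.AnabelianGeometry.SemiGraphs Literature.AnabelianGeometry.SemiGraphs.GaloisObjects

universe u₀ v₀ w'

section LevelNPin

variable {K : Type u₀} [Field K] {X : SemiGraphs.TemperedArithmeticGroup.{u₀} K} {D₀ : Type u₀} [Category.{v₀} D₀]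
  {V : FrdIMonoidStub.{max u₀ w'}} {T₀ : RealifiedDivisorMonoids (D₀ := D₀) V}
  {VD : FrdICatStub.{u₀ + 1, u₀, max u₀ w'} (ConnectedPart (BTemp X.Pi))}
  {tf : TemperedFrobenioid T₀ (ConnectedPart (BTemp X.Pi)) VD} {hZ : tf.monoidType = MonoidType.Z}
  {hP : ∀ A : (ConnectedPart (BTemp X.Pi))ᵒᵖ, IsPerfect (tf.Φ.carrier A)}
  {NH : Subgroup (Field.absoluteGaloisGroup K) → tf.category → ℕ+ → Prop}
  {lv N : ℕ+} {l' : ℕ} {RD : RigidData.{max u₀ w'} N l'} {ιX : RD.PiX ≃ₜ* X.Pi}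
  {pullFrac : ∀ {A A' : (BiKummerSetting.mkOfConnectedTemperoidYdd X tf hZ hP NH RD.toThetaEnvData ιX).C} (_ : A' ⟶ A),
    (BiKummerSetting.mkOfConnectedTemperoidYdd X tf hZ hP NH RD.toThetaEnvData ιX).biratUnits A →
      (BiKummerSetting.mkOfConnectedTemperoidYdd X tf hZ hP NH RD.toThetaEnvData ιX).biratUnits A'}
  {θ : (BiKummerSetting.mkOfConnectedTemperoidYdd X tf hZ hP NH RD.toThetaEnvData ιX).biratUnits
    (BiKummerSetting.mkOfConnectedTemperoidYdd X tf hZ hP NH RD.toThetaEnvData ιX).Aodot}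
  {Bl : (BiKummerSetting.mkOfConnectedTemperoidYdd X tf hZ hP NH RD.toThetaEnvData ιX).C}
  {Pl : (BiKummerSetting.mkOfConnectedTemperoidYdd X tf hZ hP NH RD.toThetaEnvData ιX).FractionPair θ Bl}
  {Rl : (BiKummerSetting.mkOfConnectedTemperoidYdd X tf hZ hP NH RD.toThetaEnvData ιX).NthRoot θ Pl lv pullFrac}
  [RD.iotaN.range.Normal]
  (h : ModelFrobenioid.Hypotheses tf.divisorMonoid tf.ratFnFunctor) (odd_l : Odd (lv : ℕ))
  (R : (BiKummerSetting.mkOfConnectedTemperoidYdd X tf hZ hP NH RD.toThetaEnvData ιX).NthRoot Rl.root Rl.pair N pullFrac)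
  (K' : Type (max u₀ w')) [Field K'] (constEmb : K'ˣ →* tf.biratUnitsModel R.BN) (constEmb_injective : Function.Injective constEmb)
  (hinvc : ∀ g : Aut R.AN.base,
    pull tf.divisorMonoid g.hom (ModelFrobenioid.div R.pair.num) = ModelFrobenioid.div R.pair.num)
  (hinvp : ∀ y : RD.PiX, y ∈ RD.PiYdd →
    pull tf.divisorMonoid ((BiKummerSetting.mkOfConnectedTemperoidYdd X tf hZ hP NH RD.toThetaEnvData ιX).galoisSurj R.AN.base
      R.αData.isGalois (ιX y)).hom (ModelFrobenioid.div R.pair.den) = ModelFrobenioid.div R.pair.den)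
  (P : ThetaSubquotientProj (ofConnectedTemperoidData h (RD.levelStub ιX) odd_l R ιX K' constEmb constEmb_injective hinvc hinvp))
  (hPpre : P.pre R.BN.base =
    (ThetaSubquotient.autPre (RD.qN ιX) RD.iotaN R.BN.base.obj).comap (Functor.mapAut R.BN.base (connectedObjects (BTemp X.Pi)).ι))
  (hPproj_pin : ∀ (σ : P.pre R.BN.base) (τ : ThetaSubquotient.autPre (RD.qN ιX) RD.iotaN R.BN.base.obj),
    Functor.mapAut R.BN.base (connectedObjects (BTemp X.Pi)).ι (σ : Aut R.BN.base) = (τ : Aut R.BN.base.obj) →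
      (P.proj R.BN.base σ : ThetaSubquotient.LDelta (RD.qN ιX) RD.iotaN R.BN.base.obj) =
        ThetaSubquotient.autProj (RD.qN ιX) RD.iotaN R.BN.base.obj τ)

include hPpre hPproj_pin

omit hPpre in
/-- **`(e, he, hPproj)` DISCHARGED under the projection pin**, in EXACTLY the binder types of abc-iut-L2-t4's
`cyclotomicRigidity_ofConnectedTemperoidData_of_pullRoot` (p430047) at `Q := RD.levelStub ιX`: there is a SURJECTIVE `e : μ_N → (l·Δ_Θ)_{B_N} ⊗ ℤ/Nℤ` with
`mk (P.proj (ρ k)) = e (thetaMod k)` for every `k ∈ Π^tp_Ÿ ∩ (l·Δ_Θ)` — p440814's record-free coefficient map read on `P` through the pin.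
[cite: MochizukiEtTh2009, Prop 5.5 p.327 (PDF p.101); §2 p.46] -/
theorem exists_coeffMap_levelN_of_pin :
    ∃ e : RD.mu → (ofConnectedTemperoidData h (RD.levelStub ιX) odd_l R ιX K' constEmb constEmb_injective hinvc hinvp).lDeltaModN
        (ofConnectedTemperoidData h (RD.levelStub ιX) odd_l R ιX K' constEmb constEmb_injective hinvc hinvp).BN,
      Function.Surjective e ∧
        ∀ (k : RD.PiYdd) (hk : (k : RD.PiX) ∈ RD.lDeltaTheta) (hm : rhoOfBiKummerData R ιX k ∈ P.pre _),
          (QuotientGroup.mk (P.proj _ ⟨rhoOfBiKummerData R ιX k, hm⟩) :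
              (ofConnectedTemperoidData h (RD.levelStub ιX) odd_l R ιX K' constEmb constEmb_injective hinvc hinvp).lDeltaModN
                (ofConnectedTemperoidData h (RD.levelStub ιX) odd_l R ιX K' constEmb constEmb_injective hinvc hinvp).BN) =
            e (RD.thetaMod ⟨k, hk⟩) := by
  obtain ⟨e, he, hPe⟩ := exists_coeffMap_autProj_levelN.{u₀, v₀, max u₀ w'} (hZ := hZ) (hP := hP) (NH := NH) R ιX
  refine ⟨e, he, fun k hk hm => ?_⟩
  have hm' : ((Functor.mapAut R.BN.base (connectedObjects (BTemp X.Pi)).ι).comp (rhoOfBiKummerData R ιX)) k ∈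
      ThetaSubquotient.autPre (RD.qN ιX) RD.iotaN R.BN.base.obj :=
    mapAut_rho_mem_autPre_of_coe_mem_lDeltaTheta R ιX k hk
  have hpin := hPproj_pin ⟨rhoOfBiKummerData R ιX k, hm⟩ ⟨_, hm'⟩ rfl
  exact (congrArg QuotientGroup.mk hpin).trans (hPe k hk hm')

/-- **`hproj` under the two pins, `B_N^bs`-spelled**: `P.pre B_N^bs` is stable under conjugation and the transport along `g` of `P.proj g'` is
`P.proj (g g' g⁻¹)` — abc-iut-w4-d042's `ThetaSubquotient.map_autProj_eq_autProj_conj` (print's `Aut`-subquotient, p429126) read through p432174's `rfl`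
dictionary `ofConnectedTemperoidData_levelN_lDeltaMap` (the data's transport IS abc-iut-L2-t9's `map`) and the pins.
[cite: MochizukiEtTh2009, Prop 5.5 p.327–328 (PDF pp.101–102)] -/
theorem hproj_levelN_of_pin_base (g g' : Aut R.BN.base) (hh : g' ∈ P.pre R.BN.base) :
    ∃ hgh : g * g' * g⁻¹ ∈ P.pre R.BN.base,
      (ofConnectedTemperoidData h (RD.levelStub ιX) odd_l R ιX K' constEmb constEmb_injective hinvc hinvp).lDeltaMap g.hom
          (P.proj R.BN.base ⟨g', hh⟩) = P.proj R.BN.base ⟨g * g' * g⁻¹, hgh⟩ := by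
  have hh' : Functor.mapAut R.BN.base (connectedObjects (BTemp X.Pi)).ι g' ∈ ThetaSubquotient.autPre (RD.qN ιX) RD.iotaN R.BN.base.obj := by
    rw [hPpre] at hh
    exact hh
  have hconj : Functor.mapAut R.BN.base (connectedObjects (BTemp X.Pi)).ι g * Functor.mapAut R.BN.base (connectedObjects (BTemp X.Pi)).ι g' * (Functor.mapAut R.BN.base (connectedObjects (BTemp X.Pi)).ι g)⁻¹ =
      Functor.mapAut R.BN.base (connectedObjects (BTemp X.Pi)).ι (g * g' * g⁻¹) := by
    rw [map_mul, map_mul, map_inv]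
  have hgh' : Functor.mapAut R.BN.base (connectedObjects (BTemp X.Pi)).ι (g * g' * g⁻¹) ∈ ThetaSubquotient.autPre (RD.qN ιX) RD.iotaN R.BN.base.obj := by
    rw [← hconj]
    exact ThetaSubquotient.conj_mem_autPre (RD.qN ιX) RD.iotaN R.BN.base.obj _ hh'
  have hgh : g * g' * g⁻¹ ∈ P.pre R.BN.base := by
    rw [hPpre]
    exact hgh'
  refine ⟨hgh, ?_⟩
  have h1 := hPproj_pin ⟨g', hh⟩ ⟨_, hh'⟩ rfl
  have h2 := hPproj_pin ⟨g * g' * g⁻¹, hgh⟩ ⟨_, hgh'⟩ rfl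
  have h3 := ThetaSubquotient.map_autProj_eq_autProj_conj (RD.qN ιX) RD.iotaN R.BN.base.property (Functor.mapAut R.BN.base (connectedObjects (BTemp X.Pi)).ι g) ⟨_, hh'⟩
  rw [ofConnectedTemperoidData_levelN_lDeltaMap.{u₀, v₀, w'}]
  change ThetaSubquotient.map (RD.qN ιX) RD.iotaN R.BN.base.property R.BN.base.property (Functor.mapAut R.BN.base (connectedObjects (BTemp X.Pi)).ι g).hom
      (P.proj R.BN.base ⟨g', hh⟩ : ThetaSubquotient.LDelta (RD.qN ιX) RD.iotaN R.BN.base.obj) =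
    (P.proj R.BN.base ⟨g * g' * g⁻¹, hgh⟩ : ThetaSubquotient.LDelta (RD.qN ιX) RD.iotaN R.BN.base.obj)
  rw [h1, h2]
  exact h3.trans (congrArg _ (Subtype.ext hconj))

/-- **The structural leaf `hproj` DISCHARGED under the two pins** — p430047's binder type verbatim (`Aut_D(B_N^bs)` spelled `Aut (𝔉.base.obj 𝔉.BN)`).
[cite: MochizukiEtTh2009, Prop 5.5 p.327–328 (PDF pp.101–102)] -/
theorem hproj_levelN_of_pin :
    ∀ (g g' : Aut ((ofConnectedTemperoidData h (RD.levelStub ιX) odd_l R ιX K' constEmb constEmb_injective hinvc hinvp).base.obj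
        (ofConnectedTemperoidData h (RD.levelStub ιX) odd_l R ιX K' constEmb constEmb_injective hinvc hinvp).BN))
      (hh : g' ∈ P.pre _), ∃ hgh : g * g' * g⁻¹ ∈ P.pre _,
        (ofConnectedTemperoidData h (RD.levelStub ιX) odd_l R ιX K' constEmb constEmb_injective hinvc hinvp).lDeltaMap g.hom
            (P.proj _ ⟨g', hh⟩) = P.proj _ ⟨g * g' * g⁻¹, hgh⟩ :=
  fun g g' hh => hproj_levelN_of_pin_base.{u₀, v₀, w'} h odd_l R K' constEmb constEmb_injective hinvc hinvp P hPpre hPproj_pin g g' hh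

end LevelNPin

end ThetaFrobenioid

end Literature.AnabelianGeometry.EtaleTheta

end
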